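import Mathlib
import Literature.AlgebraicGeometry.Resolution.RegularLocalRingsNormal
import Summits.ResolutionOfSingularities.ResolutionOfSingularities.Theorems.FrobeniusClosingSteerLowOrderSecond
import Summits.ResolutionOfSingularities.ResolutionOfSingularities.Theorems.FrobeniusClosingSteerLowOrderRankFour

/-!
# Crux `Steer` (stmt-ResolutionOfSingularities-16345), σ-residual LOW half at `p = 2`:
# `lowOrder_step_two`, from ONE blow-up step to the engines (`false_of_matrix`)

OURS (campaign `res-hironaka`, rung L ★L-G4, slot W4.1, chain W4.1; seat `res-D-pv-028` g6, res-L0-w41-plan-1 RULING 15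
(15b); replaces the role of no printed item; NOT a statement of the manuscript under review [claim: Hironaka2017,
status: under-review]; AI review is weaker than expert review).

One σ_top step `R ⊂ R₁` (the local blowing up along the centre `P = (u)` at the exceptional parameter `x`, both members
local rings at the centre of `O`, regular of dimension `4`, residues squares, characteristic `2`), the radicand
`f = s²` with `f − g_σ² = Σ G_{jk} u_j u_k ∈ P²`, and the strict transform `s = x s₁ + g₁`, `f₁ = s₁²`:
* `inclusion_sub_div_mem` — `(g_σ + g₁)/x ∈ R₁` (regular ⇒ integrally closed, `pow_dvd_pow_iff`), so that
  `f₁ = Σ G_{jk} (u_j/x)(u_k/x) + ((g_σ + g₁)/x)²`;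
* `false_of_matrix` — assembles the hypotheses of the engines (domination, the cotangent derivation of
  res-L0-w41-stub-3, layer 2's `δ`-span lemma, `Σ c_j u_j = x`) and concludes `False` from a coefficient matrix in
  NORMAL FORM (one unit pair: `LowOrderSecond.false_of_normalForm`) or in RANK-FOUR form (two unit pairs:
  `LowOrderRankFour.false_of_two_pairs`) together with a cleaning of `f₁` in `𝔫³`.
[cite: Matsumura1987, Thm. 19.4] [folklore]
-/

-- The namespace mirrors the chain's helper layout (`…Theorems.SwitchingDichotomy.<Piece>`) on purpose.
set_option linter.dupNamespace false

noncomputable section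

namespace Summit.ResolutionOfSingularities.ResolutionOfSingularities.Theorems.SwitchingDichotomy.LowOrderMatrix

open IsLocalRing Module Literature.AlgebraicGeometry.Resolution
open Summit.ResolutionOfSingularities.ResolutionOfSingularities.Theorems.SwitchingDichotomy

universe u

variable {K : Type u} [Field K] [CharP K 2]

/-! ## The correction of the cleaner lies in `R₁` -/

omit [CharP K 2] in
/-- **Normality step**: in a regular (hence integrally closed) subring `R₁` of `K`, if `a² = b² · y` with
`a, b, y ∈ R₁`, `b ≠ 0`, then `a / b ∈ R₁`. [cite: Matsumura1987, Thm. 19.4] -/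
theorem div_mem_of_sq_eq {R₁ : Subring K} [IsRegularLocalRing R₁] {a b y : R₁} (hb : (b : K) ≠ 0)
    (h : a ^ 2 = b ^ 2 * y) : (a : K) / b ∈ R₁ := by
  haveI : IsIntegrallyClosed R₁ := isIntegrallyClosed_of_isRegularLocalRing _
  obtain ⟨c, hc⟩ := (IsIntegrallyClosed.pow_dvd_pow_iff two_ne_zero).mp ⟨y, h⟩
  have : (a : K) / b = c := by
    rw [div_eq_iff hb, hc, Subring.coe_mul, mul_comm]
  rw [this]
  exact c.2

omit [CharP K 2] in
/-- Membership form of `Σ c_j u_j = x`. [folklore] -/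
theorem exists_coeffs_of_mem_span {R : Subring K} {h : ℕ} (u : Fin h → R) {x : R}
    (hx : x ∈ Ideal.span (Set.range u)) : ∃ c : Fin h → R, ∑ j, c j * u j = x :=
  Ideal.mem_span_range_iff_exists_fun.mp hx

/-! ## From one blow-up step to the engines -/

/-- **`false_of_matrix`.** One σ_top step `R ⊂ R₁` of a 2-steered run (both members `locAtCentre _ O`, `R₁` the
local blowing up of `R` along `P` at the exceptional parameter `x`, `R₁` regular of dimension `4`, residues of both
squares), generators `u` of `P` extended by `w` to generators of `𝔪_R` with `h + e = 4`, the radicand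
`f = s² ∈ R` with `f − g_σ² = Σ G_{jk} u_j u_k`, the strict transform `s = x · s₁ + g₁`, `s₁² ∈ R₁`: if the
coefficient matrix is in normal form (one unit pair) or in rank-four form (two unit pairs) then NO cleaning of
`s₁²` lies in `𝔫³`. [folklore] -/
theorem false_of_matrix (O : ValuationSubring K) (R R₁ : Subring K) [IsRegularLocalRing R] [IsRegularLocalRing R₁]
    (B B₁ : Subring K) (hB : B ≤ O.toSubring) (hB₁ : B₁ ≤ O.toSubring)
    (hRB : R = locAtCentre B O) (hR₁B : R₁ = locAtCentre B₁ O)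
    (P : Ideal R) (hbl : IsLocalBlowupAlong O R P R₁)
    (hdim₁ : ringKrullDim R₁ = 4)
    (hperf : ∀ a : R, ∃ b : R, a - b ^ 2 ∈ maximalIdeal R)
    (hperf₁ : ∀ a : R₁, ∃ b : R₁, a - b ^ 2 ∈ maximalIdeal R₁)
    (x : K) (hxR : x ∈ R) (hxP : (⟨x, hxR⟩ : R) ∈ P) (hx0 : x ≠ 0)
    (hxmax : ∀ y : R, y ∈ P → O.valuation (y : K) ≤ O.valuation x)
    (s s₁ g₁ : K) (hg₁ : g₁ ∈ R) (hstep : s = x * s₁ + g₁) (hs : s ^ 2 ∈ R) (hs₁ : s₁ ^ 2 ∈ R₁)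
    {h e : ℕ} (hhe : h + e = 4) (u : Fin h → R) (w : Fin e → R)
    (huw : Ideal.span (Set.range u ∪ Set.range w) = maximalIdeal R) (hPu : Ideal.span (Set.range u) = P)
    (G : Fin h → Fin h → R) (gσ : R) (hF : (⟨s ^ 2, hs⟩ : R) - gσ ^ 2 = ∑ j, ∑ k, G j k * u j * u k)
    (hcase : (∃ j₁ j₂ : Fin h, j₁ ≠ j₂ ∧ IsUnit (G j₁ j₂) ∧
        ∀ j k, j ≠ k → ¬ (j = j₁ ∧ k = j₂) → G j k ∈ maximalIdeal R) ∨
      (∃ j₁ j₂ j₃ j₄ : Fin h, j₁ ≠ j₂ ∧ j₁ ≠ j₃ ∧ j₁ ≠ j₄ ∧ j₂ ≠ j₃ ∧ j₂ ≠ j₄ ∧ j₃ ≠ j₄ ∧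
        (∀ j, j = j₁ ∨ j = j₂ ∨ j = j₃ ∨ j = j₄) ∧ IsUnit (G j₁ j₂) ∧ IsUnit (G j₃ j₄) ∧
        ∀ j k, j ≠ k → ¬ (j = j₁ ∧ k = j₂) → ¬ (j = j₃ ∧ k = j₄) → G j k ∈ maximalIdeal R))
    (hhigh : ∃ g' : R₁, (⟨s₁ ^ 2, hs₁⟩ : R₁) - g' ^ 2 ∈ maximalIdeal R₁ ^ 3) : False := by
  classical
  have hRR₁ : R ≤ R₁ := hbl.isLocalBlowup.le
  have hRO : R ≤ O.toSubring := hbl.1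
  have hR₁O : R₁ ≤ O.toSubring := hbl.isLocalBlowup.target_le
  -- ### domination: maximal ideals are the elements of value `< 1`
  have hdomR : ∀ a : R, a ∈ maximalIdeal R ↔ O.valuation (a : K) < 1 := by
    have hd : SubringDominates R O.toSubring := by rw [hRB]; exact subringDominates_locAtCentre hB
    exact (subringDominates_valuationSubring_iff hRO).mp hd
  have hdomR₁ : ∀ a : R₁, a ∈ maximalIdeal R₁ ↔ O.valuation (a : K) < 1 := by
    have hd : SubringDominates R₁ O.toSubring := by rw [hR₁B]; exact subringDominates_locAtCentre hB₁
    exact (subringDominates_valuationSubring_iff hR₁O).mp hd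
  have hloc : ∀ m : R, m ∈ maximalIdeal R → residue R₁ (Subring.inclusion hRR₁ m) = 0 := by
    intro m hm
    rw [residue_eq_zero_iff, hdomR₁]
    exact (hdomR m).mp hm
  -- ### the exceptional parameter and the quotients `u_j / x` in `R₁`
  have hPle : P ≤ maximalIdeal R := by
    rw [← hPu, Ideal.span_le]
    rintro _ ⟨j, rfl⟩
    rw [← huw]
    exact Ideal.subset_span (Or.inl ⟨j, rfl⟩)
  set x' : R₁ := ⟨x, hRR₁ hxR⟩ with hx'
  have hx'm : x' ∈ maximalIdeal R₁ := by
    rw [hdomR₁]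
    exact (hdomR ⟨x, hxR⟩).mp (hPle hxP)
  have hx'0 : x' ≠ 0 := fun hh => hx0 (congrArg Subtype.val hh)
  have huP : ∀ j, u j ∈ P := fun j => hPu ▸ Ideal.subset_span ⟨j, rfl⟩
  have hvmem : ∀ j, ((u j : R) : K) / x ∈ R₁ := fun j =>
    LowOrderChart.div_mem_of_isLocalBlowupAlong hbl hxR hxP hx0 hxmax (huP j)
  set v : Fin h → R₁ := fun j => ⟨((u j : R) : K) / x, hvmem j⟩ with hvdef
  have hvK : ∀ j, (v j : K) = ((u j : R) : K) / x := fun j => rfl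
  have hv : ∀ j, Subring.inclusion hRR₁ (u j) = x' * v j := by
    intro j
    apply Subtype.ext
    change ((u j : R) : K) = x * (((u j : R) : K) / x)
    rw [mul_div_cancel₀ _ hx0]
  obtain ⟨c, hc⟩ := exists_coeffs_of_mem_span u (hPu ▸ hxP : (⟨x, hxR⟩ : R) ∈ Ideal.span (Set.range u))
  have hincl : Subring.inclusion hRR₁ ⟨x, hxR⟩ = x' := Subtype.ext rfl
  have hc' : Subring.inclusion hRR₁ (∑ j, c j * u j) = x' := (congrArg (Subring.inclusion hRR₁) hc).trans hincl
  -- ### the cotangent derivation of `R₁` and the span lemma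
  obtain ⟨δ, -, hδadd, hδmul, hδmem, hδsq⟩ := CotangentDerivation.exists_cotangentDerivation (R := R₁) hperf₁
  have hR₁chart := LowOrderChart.eq_locAtCentre_closure_div hbl hxR hxP hx0 hxmax
  have hspan := LowOrderChart.span_delta_eq_top hR₁chart hRR₁ u hPu v hvK δ hδadd hδmul hδmem hδsq
  -- ### `finrank 𝔫/𝔫² = 4`
  have hfin : finrank (ResidueField R₁) (CotangentSpace R₁) = 4 := by
    have h1 := (IsRegularLocalRing.iff_finrank_cotangentSpace R₁).mp inferInstance
    rw [hdim₁] at h1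
    exact_mod_cast h1
  -- ### the transformed radicand: `f₁ = Σ G (u_j/x)(u_k/x) + ((g_σ + g₁)/x)²`
  set Fx : R₁ := ∑ j, ∑ k, Subring.inclusion hRR₁ (G j k) * v j * v k with hFx
  have hFxK : (Fx : K) * x ^ 2 = (((⟨s ^ 2, hs⟩ : R) - gσ ^ 2 : R) : K) := by
    rw [hF, hFx]
    push_cast
    rw [Finset.sum_mul]
    refine Finset.sum_congr rfl fun j _ => ?_
    rw [Finset.sum_mul]
    refine Finset.sum_congr rfl fun k _ => ?_
    rw [Subring.coe_inclusion, hvK, hvK]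
    field_simp
  set a : R₁ := Subring.inclusion hRR₁ gσ + ⟨g₁, hRR₁ hg₁⟩ with ha
  have hsqK : (((gσ : R) : K) + g₁) ^ 2 = x ^ 2 * (s₁ ^ 2 - (Fx : K)) := by
    have h2K : (2 : K) = 0 := CharTwo.two_eq_zero
    have e1 : x ^ 2 * (Fx : K) = s ^ 2 - ((gσ : R) : K) ^ 2 := by
      rw [mul_comm, hFxK]; push_cast; ring
    have e2 : x * s₁ = s - g₁ := by rw [hstep]; ring
    linear_combination e1 + (-(x * s₁ + s - g₁)) * e2 + (g₁ * ((gσ : R) : K) + g₁ * s) * h2K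
  have hsq : a ^ 2 = x' ^ 2 * ((⟨s₁ ^ 2, hs₁⟩ : R₁) - Fx) := by
    apply Subtype.ext
    change (((gσ : R) : K) + g₁) ^ 2 = x ^ 2 * (s₁ ^ 2 - (Fx : K))
    exact hsqK
  obtain hq := div_mem_of_sq_eq (y := (⟨s₁ ^ 2, hs₁⟩ : R₁) - Fx) (by exact hx0) hsq
  set q : R₁ := ⟨(a : K) / x', hq⟩ with hqdef
  have hf₁ : (⟨s₁ ^ 2, hs₁⟩ : R₁) = ∑ j, ∑ k, Subring.inclusion hRR₁ (G j k) * v j * v k + 0 + q ^ 2 := by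
    rw [add_zero, ← hFx]
    apply Subtype.ext
    change s₁ ^ 2 = (Fx : K) + ((((gσ : R) : K) + g₁) / x) ^ 2
    rw [div_pow, hsqK, mul_div_cancel_left₀ _ (pow_ne_zero 2 hx0)]
    ring
  have hθ : (0 : R₁) ∈ Ideal.span (Set.range (Fin.cons x' (fun l => Subring.inclusion hRR₁ (w l)) : Fin (e + 1) → R₁)) :=
    Ideal.zero_mem _
  -- ### the engines
  rcases hcase with ⟨j₁, j₂, h12, hunit, hoff⟩ | ⟨j₁, j₂, j₃, j₄, h12, h13, h14, h23, h24, h34, hcover, hu12, hu34, hoff⟩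
  · exact LowOrderSecond.false_of_normalForm hRR₁ hloc hperf u w huw x' hx'm hx'0 v hv c hc' δ hδadd hδmul hδmem
      hδsq hfin hhe hspan G 0 q _ hθ hf₁ j₁ j₂ h12 hunit hoff hhigh
  · exact LowOrderRankFour.false_of_two_pairs hRR₁ hloc hperf u w huw x' hx'm hx'0 v hv c hc' δ hδadd hδmul hδmem
      hδsq hfin hhe hspan G 0 q _ hθ hf₁ j₁ j₂ j₃ j₄ h12 h13 h14 h23 h24 h34 hcover hu12 hu34 hoff
      (hhigh.imp fun g' hg' => Ideal.pow_le_pow_right (by norm_num) hg')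

end Summit.ResolutionOfSingularities.ResolutionOfSingularities.Theorems.SwitchingDichotomy.LowOrderMatrix

end
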